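import Literature.Probability.RandomPlanarGeometry.YangBaxterSAWGluing
import Literature.Probability.RandomPlanarGeometry.YangBaxterSAWYBIdentities
import Mathlib.Data.List.Sort
import Mathlib.Data.List.Sections
import HarnessLib

/-!
# The Yang–Baxter equation for the hexagon of the column exchange (Glazman–Manolescu, Proposition 3.1)

Topic `Literature/Probability/RandomPlanarGeometry`; fourth support file for the discharge of the
named fact `Literature.Probability.RandomPlanarGeometry.SAW.YangBaxter.GlazmanManolescu2019_prop42`
(`YangBaxterSAWTwoPoint.lean`): A. Glazman, I. Manolescu, *Self-avoiding walk on `ℤ²` with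
Yang–Baxter weights: universality of critical fugacity and 2-point function*, Ann. Inst. Henri
Poincaré Probab. Stat. 56 (2020), arXiv:1708.00395 (`GlazmanManolescu2019`), **Proposition 3.1**
(the Yang–Baxter equation): "Let `H` be a hexagon formed of three rhombi … `H'` the rearrangement
of the three rhombi … For any choice of distinct vertices `x₁, y₁, …, x_k, y_k` on the edges of
`∂H`, `Σ_{γ_i ⊂ H, γ_i : x_i → y_i} w_H(γ₁ ∪ ⋯ ∪ γ_k) = Σ_{γ_i ⊂ H'} w_{H'}(γ₁ ∪ ⋯ ∪ γ_k)`. … The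
proof consists simply of listing for each choice of `x₁, y₁, …, x_k, y_k` (`k` is always smaller
than `3`) the weights for all possible connections in the two tilings and explicitly computing their
sum."

This file PROVES this for the hexagon of the column exchange of §4.2 (`Zloc_topHex_eq_botHex`):
the rhombus `r` of angle `θ₂ − θ₁` on top of the two column rhombi `A, B` of angles `θ₁, θ₂`
(`topHex`, Fig. 6 left) versus the column rhombi, angles exchanged, on top of `r` (`botHex`), in
the combinatorial encoding of `YangBaxterSAWComplex.lean` (`hexCx`: a `Cx HFace HEdge` from a side
table; both are `Cx.Lawful`, checked by `decide`). The two sides of the equation are the local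
partition functions `Cx.Zloc` of `YangBaxterSAWComplex.lean` (sums over the locally admissible
families `Cx.LocValid` of the gluing argument, `YangBaxterSAWGluing.lean`).

* **The listing is done by the kernel** (`ybGood_allAdmissible`, `decide +kernel`, a few seconds):
  a computable enumeration `hexSols` of the locally admissible families (proved complete and sound,
  `mem_hexSols_iff`, `locSol_hexCx`), the symbolic weight of each solution (`monomial`: codes
  `6a + w` for the weight `w ∈ {u₁, u₂, v, w₁, w₂}` of eq. (1) at the angle `a ∈ {θ₁, θ₂, θ₂ − θ₁}`,
  `Zloc_hexCx`: `Z_H(P) = evalSym (symZ P)`), and, for each of the `1111` admissible lists `P` of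
  pairs of distinct boundary edges (`allAdmissible`, proved exhaustive: `mem_allAdmissible`), the
  check that the symbolic partition functions of `H` and `H'` are literally equal or form one of the
  nineteen identities of `YangBaxterSAWYBIdentities.lean` (`ybTable`, proved there).
* **Local transport** (`Cx.LocEmb`, `Cx.LocEmb.Zloc_map`): the local partition function of a piece
  `H` of a big lawful complex `K` (a `Cx.SubCx`) onto which a small complex `X` embeds compatibly
  with sides and angles equals that of `X` — so that the two hexagons of this file can be plugged
  into Corollary 3.2 (`Cx.wsum_eq_of_Zloc_eq`) for the defect tilings of the column exchange.
-/

noncomputable section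

open Real

namespace Literature.Probability.RandomPlanarGeometry.SAW.YangBaxter

/-! ### The two hexagons -/

/-- The nine edges of a hexagon of three rhombi: the six boundary edges `TL, Lf, BL, BR, R, TR`
(top-left, left, bottom-left, bottom-right, right, top-right, counterclockwise) and the three
interior ones. [cite: GlazmanManolescu2019, Proposition 3.1, Fig. 5] -/
inductive HEdge : Type
  | TL | Lf | BL | BR | R | TR | rhoL | rhoR | m
  deriving DecidableEq, Repr, Inhabited

/-- The three rhombi of a hexagon: `r` (the rhombus of angle `θ₂ − θ₁`), `A`, `B` (the two column
rhombi, of angles `θ₁`, `θ₂`). [cite: GlazmanManolescu2019, Proposition 3.1, Fig. 5] -/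
inductive HFace : Type
  | r | A | B
  deriving DecidableEq, Repr, Inhabited

namespace HEdge

/-- The list of all edges. [folklore] -/
def all : List HEdge := [TL, Lf, BL, BR, R, TR, rhoL, rhoR, m]

/-- The boundary edges `∂H`. [cite: GlazmanManolescu2019, Proposition 3.1] -/
def bd : List HEdge := [TL, Lf, BL, BR, R, TR]

/-- The interior edges. [cite: GlazmanManolescu2019, Proposition 3.1] -/
def int : List HEdge := [rhoL, rhoR, m]

/-- `HEdge` is a finite type (nine edges). [folklore] -/
instance : Fintype HEdge := ⟨⟨HEdge.all, by decide⟩, fun x => by cases x <;> decide⟩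

end HEdge

namespace HFace

/-- The list of all faces. [folklore] -/
def all : List HFace := [r, A, B]

/-- `HFace` is a finite type (three faces). [folklore] -/
instance : Fintype HFace := ⟨⟨HFace.all, by decide⟩, fun x => by cases x <;> decide⟩

end HFace

/-- **The hexagon `H`: the rhombus `r` on top of the column rhombi `A` (left, angle `θ₁`) and `B`
(right, angle `θ₂`)** — the side table. In the defect tilings of the column exchange, `r` is the
added rhombus (sides: lower-left `W`, lower-right `S`, upper-left `N`, upper-right `E`, so that its
`θ`-corners `N ∩ W`, `S ∩ E` are its left and right vertices, of angle `θ₂ − θ₁`), `A, B` are the two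
grid faces below it. [cite: GlazmanManolescu2019, Proposition 3.1, Fig. 5 (left) and Fig. 6] -/
def topTbl : HFace → Side → HEdge
  | .r, .N => .TL | .r, .E => .TR | .r, .W => .rhoL | .r, .S => .rhoR
  | .A, .W => .Lf | .A, .S => .BL | .A, .E => .m | .A, .N => .rhoL
  | .B, .W => .m | .B, .S => .BR | .B, .E => .R | .B, .N => .rhoR

/-- **The hexagon `H'`: the column rhombi `A` (left, now of angle `θ₂`) and `B` (right, angle `θ₁`)
on top of `r`** — the side table; same boundary edges. [cite: GlazmanManolescu2019, Proposition 3.1, Fig. 5 (middle) and Fig. 6] -/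
def botTbl : HFace → Side → HEdge
  | .A, .W => .Lf | .A, .S => .rhoL | .A, .E => .m | .A, .N => .TL
  | .B, .W => .m | .B, .S => .rhoR | .B, .E => .R | .B, .N => .TR
  | .r, .N => .rhoL | .r, .E => .rhoR | .r, .W => .BL | .r, .S => .BR

section Tables

variable (tbl : HFace → Side → HEdge)

/-- The side of a face an edge lies on, from the side table. [folklore] -/
def hexSideOf (f : HFace) (e : HEdge) : Option Side :=
  if tbl f .W = e then some .W else if tbl f .E = e then some .E
  else if tbl f .S = e then some .S else if tbl f .N = e then some .N else none

/-- The common face of two edges, from the side table. [folklore] -/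
def hexCommonFace (e e' : HEdge) : Option HFace :=
  if e = e' then none
  else if (hexSideOf tbl .r e).isSome ∧ (hexSideOf tbl .r e').isSome then some .r
  else if (hexSideOf tbl .A e).isSome ∧ (hexSideOf tbl .A e').isSome then some .A
  else if (hexSideOf tbl .B e).isSome ∧ (hexSideOf tbl .B e').isSome then some .B
  else none

/-- **A hexagon as a rhombic complex**, from its side table and its angles. [cite: GlazmanManolescu2019, Proposition 3.1] -/
def hexCx (ang : HFace → ℝ) : Cx HFace HEdge where
  side := tbl
  sideOf := hexSideOf tbl
  commonFace := hexCommonFace tbl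
  angle := ang

end Tables

/-- The angles of `H`: `r ↦ θ₂ − θ₁`, `A ↦ θ₁`, `B ↦ θ₂`. [cite: GlazmanManolescu2019, Proposition 3.1 and §4.2] -/
def topAng (θ₁ θ₂ : ℝ) : HFace → ℝ
  | .r => θ₂ - θ₁ | .A => θ₁ | .B => θ₂

/-- The angles of `H'`: `A ↦ θ₂`, `B ↦ θ₁`, `r ↦ θ₂ − θ₁` (the column angles are exchanged).
[cite: GlazmanManolescu2019, Proposition 3.1 and §4.2] -/
def botAng (θ₁ θ₂ : ℝ) : HFace → ℝ
  | .r => θ₂ - θ₁ | .A => θ₂ | .B => θ₁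

/-- **The hexagon `H` (before the Yang–Baxter transformation).** [cite: GlazmanManolescu2019, Proposition 3.1] -/
def topHex (θ₁ θ₂ : ℝ) : Cx HFace HEdge := hexCx topTbl (topAng θ₁ θ₂)

/-- **The hexagon `H'` (after the Yang–Baxter transformation).** [cite: GlazmanManolescu2019, Proposition 3.1] -/
def botHex (θ₁ θ₂ : ℝ) : Cx HFace HEdge := hexCx botTbl (botAng θ₁ θ₂)

/-- The interior edges as a finite set. [cite: GlazmanManolescu2019, Proposition 3.1] -/
def hexInt : Finset HEdge := {.rhoL, .rhoR, .m}

/-! ### The computable enumeration of the local solutions -/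

section Enum

variable (tbl : HFace → Side → HEdge)

/-- Lists over `l` of length `n`. [folklore] -/
def listsLen {α : Type*} (l : List α) : ℕ → List (List α)
  | 0 => [[]]
  | n + 1 => (listsLen l n).flatMap fun t => l.map (· :: t)

/-- Lists over `l` of length `≤ n`. [folklore] -/
def listsUpTo {α : Type*} (l : List α) : ℕ → List (List α)
  | 0 => listsLen l 0
  | n + 1 => listsUpTo l n ++ listsLen l (n + 1)

/-- The candidate interior blocks: lists of interior edges without repetition. [folklore] -/
def hexBlocks : List (List HEdge) := (listsUpTo HEdge.int 3).filter fun b => b.Nodup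

/-- Boolean chain test. [folklore] -/
def chainB {α : Type*} (R : α → α → Bool) : List α → Bool
  | a :: b :: l => R a b && chainB R (b :: l)
  | _ => true

/-- Boolean version of the clauses of `Cx.LocValid` for the hexagon `hexCx tbl` (all faces in `H`,
interior edges `hexInt`). [cite: GlazmanManolescu2019, Proposition 3.1] -/
def locValidB (P : List (HEdge × HEdge)) (κ : List (List HEdge)) : Bool :=
  (κ.length == P.length) &&
  (κ.all fun b => b.all fun e => e ∈ HEdge.int) &&
  κ.flatten.Nodup &&
  ((Cx.insidePairs P κ).all fun p => (hexCommonFace tbl p.1 p.2).isSome) &&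
  ((Cx.insideRuns P κ).all fun r =>
    chainB (fun p q => hexCommonFace tbl p.1 p.2 != hexCommonFace tbl q.1 q.2) (pairsOf r)) &&
  (HFace.all.all fun f =>
    !(((tbl f .W, tbl f .E) ∈ Cx.insidePairs P κ || (tbl f .E, tbl f .W) ∈ Cx.insidePairs P κ) &&
      ((tbl f .S, tbl f .N) ∈ Cx.insidePairs P κ || (tbl f .N, tbl f .S) ∈ Cx.insidePairs P κ)))

/-- The candidate blocks for a single gap: those admissible on their own. [folklore] -/
def hexSingle (xy : HEdge × HEdge) : List (List HEdge) := hexBlocks.filter fun b => locValidB tbl [xy] [b]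

/-- The computable list of local solutions: all families of candidate blocks, one per gap,
passing `locValidB`. [cite: GlazmanManolescu2019, Proposition 3.1 ("listing … all possible connections")] -/
def hexSols (P : List (HEdge × HEdge)) : List (List (List HEdge)) :=
  ((P.map (hexSingle tbl)).sections).filter (locValidB tbl P)

/-- The kind of an arc, from the side table. [folklore] -/
def hexArcKind (p : HEdge × HEdge) : Option ArcKind :=
  (hexCommonFace tbl p.1 p.2).bind fun f =>
    match hexSideOf tbl f p.1, hexSideOf tbl f p.2 with
    | some s, some t => some (arcKind s t)
    | _, _ => none

/-- The kinds of the inside arcs in a face, from the side table. [folklore] -/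
def hexKinds (P : List (HEdge × HEdge)) (κ : List (List HEdge)) (f : HFace) : List ArcKind :=
  (Cx.insidePairs P κ).filterMap fun p => if hexCommonFace tbl p.1 p.2 = some f then hexArcKind tbl p else none

/-- Symbols for the five local weights `u₁, u₂, v, w₁, w₂` (codes `0 … 4`), `1` (empty rhombus,
`none`) and `0` (impossible configuration, code `5`). [cite: GlazmanManolescu2019, Fig. 1] -/
def wsymOf : List ArcKind → Option ℕ
  | [] => none
  | [.corner] => some 0
  | [.coCorner] => some 1
  | [.straight] => some 2
  | [.corner, .corner] => some 3
  | [.coCorner, .coCorner] => some 4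
  | _ => some 5

/-- The symbolic weight of a solution: the codes `6 · a(f) + w(f)` of the non-empty faces, where
`a(f) ∈ {0, 1, 2}` says whether the angle of `f` is `θ₁`, `θ₂` or `θ₂ − θ₁` (`angCode`), sorted.
[folklore] -/
def monomial (angCode : HFace → ℕ) (P : List (HEdge × HEdge)) (κ : List (List HEdge)) : List ℕ :=
  (HFace.all.filterMap fun f => (wsymOf (hexKinds tbl P κ f)).map fun w => 6 * angCode f + w).insertionSort (· ≤ ·)

/-- Lexicographic comparison of code lists. [folklore] -/
def lexLe : List ℕ → List ℕ → Bool
  | [], _ => true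
  | _ :: _, [] => false
  | a :: l, b :: l' => if a < b then true else if b < a then false else lexLe l l'

/-- **The symbolic local partition function**: the sorted list of the monomials of the solutions.
[cite: GlazmanManolescu2019, Proposition 3.1] -/
def symZ (angCode : HFace → ℕ) (P : List (HEdge × HEdge)) : List (List ℕ) :=
  ((hexSols tbl P).map (monomial tbl angCode P)).insertionSort fun a b => lexLe a b = true

end Enum

/-- The angle codes of `H`: `A ↦ θ₁` (0), `B ↦ θ₂` (1), `r ↦ θ₂ − θ₁` (2). [cite: GlazmanManolescu2019, §4.2] -/
def topCode : HFace → ℕ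
  | .A => 0 | .B => 1 | .r => 2

/-- The angle codes of `H'`: `A ↦ θ₂` (1), `B ↦ θ₁` (0), `r ↦ θ₂ − θ₁` (2). [cite: GlazmanManolescu2019, §4.2] -/
def botCode : HFace → ℕ
  | .A => 1 | .B => 0 | .r => 2

/-- Admissible gap lists: pairs of boundary edges, all distinct. [cite: GlazmanManolescu2019, Proposition 3.1 ("distinct vertices x₁, y₁, …, x_k, y_k on the edges of ∂H")] -/
def admissibleB (P : List (HEdge × HEdge)) : Bool :=
  (P.all fun p => p.1 ∈ HEdge.bd && p.2 ∈ HEdge.bd) && (P.flatMap fun p => [p.1, p.2]).Nodup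

/-- The lists of `n` distinct elements of `l`. [folklore] -/
def injLists (l : List HEdge) : ℕ → List (List HEdge)
  | 0 => [[]]
  | n + 1 => l.flatMap fun a => (injLists (l.erase a) n).map (a :: ·)

/-- Pairing up a list of edges. [folklore] -/
def toPairs : List HEdge → List (HEdge × HEdge)
  | a :: b :: l => (a, b) :: toPairs l
  | _ => []

/-- All admissible gap lists (they have at most three gaps). [cite: GlazmanManolescu2019, Proposition 3.1 ("k is always smaller than 3")] -/
def allAdmissible : List (List (HEdge × HEdge)) :=
  ((List.range 4).flatMap fun k => injLists HEdge.bd (2 * k)).map toPairs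

/-! ### Lawfulness of the two hexagons -/

/-- The look-up tables of `H` are the partial inverses of its side table. [folklore] -/
theorem topTbl_lawful_tables :
    (∀ (f : HFace) (e : HEdge) (s : Side), hexSideOf topTbl f e = some s ↔ topTbl f s = e) ∧
    (∀ (e e' : HEdge) (f : HFace), hexCommonFace topTbl e e' = some f ↔
      e ≠ e' ∧ (∃ s, topTbl f s = e) ∧ ∃ t, topTbl f t = e') := by
  constructor <;> decide

/-- The look-up tables of `H'` are the partial inverses of its side table. [folklore] -/
theorem botTbl_lawful_tables :
    (∀ (f : HFace) (e : HEdge) (s : Side), hexSideOf botTbl f e = some s ↔ botTbl f s = e) ∧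
    (∀ (e e' : HEdge) (f : HFace), hexCommonFace botTbl e e' = some f ↔
      e ≠ e' ∧ (∃ s, botTbl f s = e) ∧ ∃ t, botTbl f t = e') := by
  constructor <;> decide

/-- `H` is a lawful complex. [folklore] -/
theorem topHex_lawful (θ₁ θ₂ : ℝ) : (topHex θ₁ θ₂).Lawful :=
  ⟨topTbl_lawful_tables.1, topTbl_lawful_tables.2⟩

/-- `H'` is a lawful complex. [folklore] -/
theorem botHex_lawful (θ₁ θ₂ : ℝ) : (botHex θ₁ θ₂).Lawful :=
  ⟨botTbl_lawful_tables.1, botTbl_lawful_tables.2⟩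

/-! ### The enumeration is correct: `hexSols` lists the locally admissible families -/

section Correct

variable (tbl : HFace → Side → HEdge)

/-- Every face is in the list of faces. [folklore] -/
theorem HFace.mem_all (f : HFace) : f ∈ HFace.all := by cases f <;> decide

/-- The interior edges, as a list and as a finite set. [folklore] -/
theorem mem_hexInt_iff (e : HEdge) : e ∈ hexInt ↔ e ∈ HEdge.int := by
  cases e <;> decide

/-- `chainB` decides `List.IsChain`. [folklore] -/
theorem chainB_eq_true_iff {α : Type*} (R : α → α → Bool) (l : List α) :
    chainB R l = true ↔ l.IsChain fun a b => R a b = true := by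
  induction l with
  | nil => simp [chainB]
  | cons a l ih =>
    cases l with
    | nil => simp [chainB]
    | cons b l => rw [chainB, Bool.and_eq_true, ih, List.isChain_cons_cons]

/-- **`locValidB` decides `Cx.LocValid`** for the hexagon `hexCx tbl ang` (all faces, interior
edges `hexInt`). [cite: GlazmanManolescu2019, Proposition 3.1] -/
theorem locValidB_iff (ang : HFace → ℝ) (P : List (HEdge × HEdge)) (κ : List (List HEdge)) :
    locValidB tbl P κ = true ↔ (hexCx tbl ang).LocValid Finset.univ hexInt P κ := by
  have hchain : ∀ r : List HEdge,
      chainB (fun p q => hexCommonFace tbl p.1 p.2 != hexCommonFace tbl q.1 q.2) (pairsOf r) = true ↔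
        (pairsOf r).IsChain fun p q => (hexCx tbl ang).arcFace p ≠ (hexCx tbl ang).arcFace q := by
    intro r
    rw [chainB_eq_true_iff]
    simp only [bne_iff_ne, ne_eq]
    rfl
  simp only [locValidB, Bool.and_eq_true, List.all_eq_true, decide_eq_true_eq, beq_iff_eq, Option.isSome_iff_exists,
    Bool.not_eq_true', Bool.and_eq_false_iff, Bool.or_eq_false_iff, decide_eq_false_iff_not, hchain]
  constructor
  · rintro ⟨⟨⟨⟨⟨h1, h2⟩, h3⟩, h4⟩, h5⟩, h6⟩
    refine ⟨h1, fun b hb e he => (mem_hexInt_iff e).2 (h2 b hb e he), h3,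
      fun p hp => ?_, h5, fun f _ hWE hSN => ?_⟩
    · obtain ⟨f, hf⟩ := h4 p hp
      exact ⟨f, Finset.mem_univ _, hf⟩
    · rcases h6 f (HFace.mem_all f) with ⟨h, h'⟩ | ⟨h, h'⟩
      · exact hWE.elim h h'
      · exact hSN.elim h h'
  · rintro ⟨h1, h2, h3, h4, h5, h6⟩
    refine ⟨⟨⟨⟨⟨h1, fun b hb e he => (mem_hexInt_iff e).1 (h2 b hb e he)⟩, h3⟩, fun p hp => ?_⟩, h5⟩, fun f _ => ?_⟩
    · obtain ⟨f, -, hf⟩ := h4 p hp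
      exact ⟨f, hf⟩
    · by_cases hWE : (tbl f .W, tbl f .E) ∈ Cx.insidePairs P κ ∨ (tbl f .E, tbl f .W) ∈ Cx.insidePairs P κ
      · have := h6 f (Finset.mem_univ _) hWE
        exact Or.inr (not_or.1 this)
      · exact Or.inl (not_or.1 hWE)

/-- Membership in `listsLen`. [folklore] -/
theorem mem_listsLen {α : Type*} (l : List α) (n : ℕ) (t : List α) (ht : ∀ x ∈ t, x ∈ l) (hn : t.length = n) :
    t ∈ listsLen l n := by
  induction n generalizing t with
  | zero => rw [List.eq_nil_of_length_eq_zero hn]; simp [listsLen]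
  | succ n ih =>
    obtain ⟨a, t, rfl⟩ := List.exists_cons_of_length_eq_add_one hn
    simp only [listsLen, List.mem_flatMap, List.mem_map]
    exact ⟨t, ih t (fun x hx => ht x (List.mem_cons_of_mem _ hx)) (by simpa using hn), a, ht a (by simp), rfl⟩

/-- Membership in `listsUpTo`. [folklore] -/
theorem mem_listsUpTo {α : Type*} (l : List α) (n : ℕ) (t : List α) (ht : ∀ x ∈ t, x ∈ l) (hn : t.length ≤ n) :
    t ∈ listsUpTo l n := by
  induction n with
  | zero => exact mem_listsLen l 0 t ht (Nat.le_zero.1 hn)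
  | succ n ih =>
    rw [listsUpTo, List.mem_append]
    rcases Nat.lt_or_eq_of_le hn with h | h
    · exact Or.inl (ih (Nat.lt_succ_iff.1 h))
    · exact Or.inr (mem_listsLen l _ t ht h)

/-- A list of interior edges without repetition is a candidate block. [folklore] -/
theorem mem_hexBlocks {b : List HEdge} (hnd : b.Nodup) (hb : ∀ e ∈ b, e ∈ HEdge.int) : b ∈ hexBlocks := by
  unfold hexBlocks
  rw [List.mem_filter, decide_eq_true_eq]
  refine ⟨mem_listsUpTo _ _ _ hb ?_, hnd⟩
  have : b.length ≤ HEdge.int.length := (List.subperm_of_subset hnd hb).length_le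
  simpa [HEdge.int] using this

variable {tbl}

/-- A locally admissible family stays admissible when its first gap is removed. [folklore] -/
theorem locValid_tail {ang : HFace → ℝ} {xy : HEdge × HEdge} {P : List (HEdge × HEdge)} {b : List HEdge}
    {κ : List (List HEdge)} (h : (hexCx tbl ang).LocValid Finset.univ hexInt (xy :: P) (b :: κ)) :
    (hexCx tbl ang).LocValid Finset.univ hexInt P κ where
  length_eq := by simpa using h.length_eq
  subset c hc := h.subset c (List.mem_cons_of_mem _ hc)
  nodup := h.nodup.sublist (by simp)
  arc_mem p hp := h.arc_mem p (by rw [Cx.insidePairs_cons]; exact List.mem_append_right _ hp)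
  isChain r hr := h.isChain r (by rw [Cx.insideRuns_cons]; exact List.mem_cons_of_mem _ hr)
  noncross f hf hWE hSN := by
    have sub : ∀ q, q ∈ Cx.insidePairs P κ → q ∈ Cx.insidePairs (xy :: P) (b :: κ) := fun q hq => by
      rw [Cx.insidePairs_cons]; exact List.mem_append_right _ hq
    exact h.noncross f hf (hWE.imp (sub _) (sub _)) (hSN.imp (sub _) (sub _))

/-- The first gap of a locally admissible family is admissible on its own. [folklore] -/
theorem locValid_head {ang : HFace → ℝ} {xy : HEdge × HEdge} {P : List (HEdge × HEdge)} {b : List HEdge}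
    {κ : List (List HEdge)} (h : (hexCx tbl ang).LocValid Finset.univ hexInt (xy :: P) (b :: κ)) :
    (hexCx tbl ang).LocValid Finset.univ hexInt [xy] [b] where
  length_eq := rfl
  subset c hc := h.subset c (by simp_all)
  nodup := h.nodup.sublist (by simp)
  arc_mem p hp := h.arc_mem p (by
    rw [Cx.insidePairs_cons]; rw [Cx.insidePairs_cons] at hp
    simp only [Cx.insidePairs_nil_left, List.append_nil] at hp
    exact List.mem_append_left _ hp)
  isChain r hr := h.isChain r (by
    rw [Cx.insideRuns_cons]; rw [Cx.insideRuns_cons] at hr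
    simp only [Cx.insideRuns_nil_left, List.mem_singleton] at hr
    exact hr ▸ List.mem_cons_self)
  noncross f hf hWE hSN := by
    have sub : ∀ q, q ∈ Cx.insidePairs [xy] [b] → q ∈ Cx.insidePairs (xy :: P) (b :: κ) := fun q hq => by
      rw [Cx.insidePairs_cons]; rw [Cx.insidePairs_cons] at hq
      simp only [Cx.insidePairs_nil_left, List.append_nil] at hq
      exact List.mem_append_left _ hq
    exact h.noncross f hf (hWE.imp (sub _) (sub _)) (hSN.imp (sub _) (sub _))

/-- **The enumeration is complete**: a locally admissible family is listed by `hexSols`.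
[cite: GlazmanManolescu2019, Proposition 3.1 ("all possible connections")] -/
theorem mem_hexSols_of_locValid {ang : HFace → ℝ} {P : List (HEdge × HEdge)} {κ : List (List HEdge)}
    (h : (hexCx tbl ang).LocValid Finset.univ hexInt P κ) : κ ∈ hexSols tbl P := by
  unfold hexSols
  rw [List.mem_filter, (locValidB_iff tbl ang P κ)]
  refine ⟨List.mem_sections.2 ?_, h⟩
  induction P generalizing κ with
  | nil =>
    obtain rfl : κ = [] := List.eq_nil_of_length_eq_zero (by simpa using h.length_eq)
    exact List.Forall₂.nil
  | cons xy P ih =>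
    obtain ⟨b, κ, rfl⟩ := List.exists_cons_of_length_eq_add_one (by simpa using h.length_eq)
    rw [List.map_cons]
    refine List.Forall₂.cons ?_ (ih (locValid_tail h))
    unfold hexSingle
    rw [List.mem_filter, locValidB_iff tbl ang]
    have hb : ∀ e ∈ b, e ∈ hexInt := h.subset b List.mem_cons_self
    exact ⟨mem_hexBlocks ((List.nodup_flatten.1 h.nodup).1 b List.mem_cons_self)
      fun e he => (mem_hexInt_iff e).1 (hb e he), locValid_head h⟩

/-- **`hexSols` lists exactly the locally admissible families.** [cite: GlazmanManolescu2019, Proposition 3.1] -/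
theorem mem_hexSols_iff (ang : HFace → ℝ) (P : List (HEdge × HEdge)) (κ : List (List HEdge)) :
    κ ∈ hexSols tbl P ↔ (hexCx tbl ang).LocValid Finset.univ hexInt P κ := by
  refine ⟨fun h => ?_, mem_hexSols_of_locValid⟩
  unfold hexSols at h
  rw [List.mem_filter] at h
  exact (locValidB_iff tbl ang P κ).1 h.2

/-- The finite set of locally admissible families is the listed one. [cite: GlazmanManolescu2019, Proposition 3.1] -/
theorem locSol_hexCx (ang : HFace → ℝ) (P : List (HEdge × HEdge)) :
    (hexCx tbl ang).locSol Finset.univ hexInt P = (hexSols tbl P).toFinset := by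
  ext κ
  rw [Cx.mem_locSol, List.mem_toFinset, mem_hexSols_iff]

/-! ### The local partition function of a hexagon is the evaluation of its symbolic form -/

/-- The angle denoted by an angle code. [cite: GlazmanManolescu2019, §4.2] -/
def angleOfCode (θ₁ θ₂ : ℝ) : ℕ → ℝ
  | 0 => θ₁
  | 1 => θ₂
  | _ => θ₂ - θ₁

/-- The local weight of a rhombus in terms of weight codes. [cite: GlazmanManolescu2019, eq. (1), Fig. 1] -/
theorem localWeight_eq_code (θ₁ θ₂ : ℝ) {a : ℕ} (ha : a ≤ 2) (ks : List ArcKind) :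
    localWeight (angleOfCode θ₁ θ₂ a) ks = ((wsymOf ks).map fun w => codeWeight θ₁ θ₂ (6 * a + w)).getD 1 := by
  interval_cases a <;>
    rcases ks with _ | ⟨k, _ | ⟨k', _ | ⟨k'', l⟩⟩⟩ <;> (try cases k) <;> (try cases k') <;>
      simp [localWeight, wsymOf, codeWeight, angleOfCode]

/-- Products over the three faces. [folklore] -/
theorem prod_univ_HFace (g : HFace → ℝ) : ∏ f, g f = g .r * g .A * g .B := by
  rw [show (Finset.univ : Finset HFace) = {.r, .A, .B} from rfl]
  rw [Finset.prod_insert (by decide), Finset.prod_insert (by decide), Finset.prod_singleton, mul_assoc]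

/-- The product of the denoted factors of a `filterMap`. [folklore] -/
theorem prod_map_filterMap_getD {α : Type*} (l : List α) (h : α → Option ℕ) (cw : ℕ → ℝ) :
    ((l.filterMap h).map cw).prod = (l.map fun a => ((h a).map cw).getD 1).prod := by
  induction l with
  | nil => simp
  | cons a l ih =>
    rw [List.filterMap_cons, List.map_cons, List.prod_cons, ← ih]
    cases h a <;> simp

/-- The kinds of the inside arcs of the hexagon complex are computed by `hexKinds`. [folklore] -/
theorem kindsLoc_hexCx (ang : HFace → ℝ) (P : List (HEdge × HEdge)) (κ : List (List HEdge)) (f : HFace) :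
    (hexCx tbl ang).kindsLoc P κ f = hexKinds tbl P κ f := by
  unfold Cx.kindsLoc hexKinds
  refine Cx.filterMap_congr_of_mem fun p _ => ?_
  have h1 : (hexCx tbl ang).arcFace p = hexCommonFace tbl p.1 p.2 := rfl
  have h2 : (hexCx tbl ang).arcKindOf p = hexArcKind tbl p := by
    unfold Cx.arcKindOf hexArcKind
    rw [h1]
    rfl
  rw [h1, h2]

/-- **The weight of a family inside the hexagon is the product of the weights denoted by its
monomial.** [cite: GlazmanManolescu2019, Proposition 3.1] -/
theorem wLoc_hexCx (ang : HFace → ℝ) (angCode : HFace → ℕ) (θ₁ θ₂ : ℝ)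
    (hang : ∀ f, ang f = angleOfCode θ₁ θ₂ (angCode f)) (hcode : ∀ f, angCode f ≤ 2)
    (P : List (HEdge × HEdge)) (κ : List (List HEdge)) :
    (hexCx tbl ang).wLoc Finset.univ P κ = ((monomial tbl angCode P κ).map (codeWeight θ₁ θ₂)).prod := by
  unfold Cx.wLoc monomial
  rw [(List.perm_insertionSort _ _).map _ |>.prod_eq, prod_map_filterMap_getD, prod_univ_HFace]
  simp only [HFace.all, List.map_cons, List.map_nil, List.prod_cons, List.prod_nil, mul_one, kindsLoc_hexCx,
    Option.map_map]
  have key : ∀ f, localWeight ((hexCx tbl ang).angle f) (hexKinds tbl P κ f) =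
      (((wsymOf (hexKinds tbl P κ f)).map fun w => 6 * angCode f + w).map (codeWeight θ₁ θ₂)).getD 1 := by
    intro f
    rw [show (hexCx tbl ang).angle f = ang f from rfl, hang f, localWeight_eq_code θ₁ θ₂ (hcode f), Option.map_map]
    rfl
  rw [key, key, key]
  simp only [Option.map_map, mul_assoc]

/-- **The local partition function of the hexagon is the evaluation of its symbolic form**
(provided the listed solutions have no repetition, checked by the kernel for the admissible gap
lists). [cite: GlazmanManolescu2019, Proposition 3.1] -/
theorem Zloc_hexCx (ang : HFace → ℝ) (angCode : HFace → ℕ) (θ₁ θ₂ : ℝ)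
    (hang : ∀ f, ang f = angleOfCode θ₁ θ₂ (angCode f)) (hcode : ∀ f, angCode f ≤ 2)
    (P : List (HEdge × HEdge)) (hnd : (hexSols tbl P).Nodup) :
    (hexCx tbl ang).Zloc Finset.univ hexInt P = evalSym θ₁ θ₂ (symZ tbl angCode P) := by
  unfold Cx.Zloc evalSym symZ
  rw [locSol_hexCx, List.sum_toFinset _ hnd, (List.perm_insertionSort _ _).map _ |>.sum_eq, List.map_map]
  exact congrArg List.sum (List.map_congr_left fun κ _ => by
    simp only [Function.comp_apply, wLoc_hexCx ang angCode θ₁ θ₂ hang hcode])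

end Correct

/-! ### The kernel listing: every admissible gap list gives a proven identity -/

/-- **The test performed by the kernel** on a gap list: the symbolic partition functions of `H`
and `H'` are literally equal, or form one of the nineteen proven identities (in either order);
and the listed solutions have no repetition. [cite: GlazmanManolescu2019, Proposition 3.1 (proof)] -/
def ybGood (P : List (HEdge × HEdge)) : Bool :=
  let L := symZ topTbl topCode P
  let R := symZ botTbl botCode P
  (L == R || ybTable.any fun e => (e.1 == L && e.2 == R) || (e.1 == R && e.2 == L)) &&
    (hexSols topTbl P).Nodup && (hexSols botTbl P).Nodup

set_option maxRecDepth 100000 in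
/-- **Proposition 3.1, the listing** ("The proof consists simply of listing for each choice of
`x₁, y₁, …, x_k, y_k` … the weights for all possible connections in the two tilings"): for each
of the `1111` admissible gap lists the kernel enumerates the solutions in `H` and `H'` and finds
literally equal symbolic partition functions or one of the nineteen identities of
`YangBaxterSAWYBIdentities.lean`. [cite: GlazmanManolescu2019, Proposition 3.1 (proof)] -/
theorem ybGood_allAdmissible : allAdmissible.all ybGood = true := by
  decide +kernel

/-- `toPairs` inverts the flattening of a list of pairs. [folklore] -/
theorem toPairs_flatMap (P : List (HEdge × HEdge)) : toPairs (P.flatMap fun p => [p.1, p.2]) = P := by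
  induction P with
  | nil => rfl
  | cons p P ih => simp [toPairs, ih]

/-- Lists of distinct elements are listed by `injLists`. [folklore] -/
theorem mem_injLists {t : List HEdge} (hnd : t.Nodup) {l : List HEdge} (ht : ∀ x ∈ t, x ∈ l) :
    t ∈ injLists l t.length := by
  induction t generalizing l with
  | nil => simp [injLists]
  | cons a t ih =>
    rw [List.nodup_cons] at hnd
    rw [List.length_cons, injLists, List.mem_flatMap]
    refine ⟨a, ht a (by simp), ?_⟩
    rw [List.mem_map]
    refine ⟨t, ih hnd.2 fun x hx => ?_, rfl⟩
    exact (List.mem_erase_of_ne (fun h : x = a => hnd.1 (h ▸ hx))).2 (ht x (List.mem_cons_of_mem _ hx))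

/-- **Every admissible gap list is listed.** [cite: GlazmanManolescu2019, Proposition 3.1 ("k is always smaller than 3")] -/
theorem mem_allAdmissible {P : List (HEdge × HEdge)} (hP : admissibleB P = true) : P ∈ allAdmissible := by
  unfold admissibleB at hP
  simp only [Bool.and_eq_true, List.all_eq_true, decide_eq_true_eq] at hP
  obtain ⟨hbd, hnd⟩ := hP
  set t := P.flatMap fun p => [p.1, p.2] with ht
  have htbd : ∀ x ∈ t, x ∈ HEdge.bd := by
    intro x hx
    simp only [ht, List.mem_flatMap, List.mem_cons, List.mem_nil_iff, or_false] at hx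
    obtain ⟨p, hp, rfl | rfl⟩ := hx
    exacts [(hbd p hp).1, (hbd p hp).2]
  have hlen : t.length = 2 * P.length := by
    rw [ht, List.length_flatMap]; simp [List.sum_replicate, two_mul]
    induction P <;> simp_all; omega
  have hle : t.length ≤ 6 := by
    have := (List.subperm_of_subset hnd htbd).length_le
    simpa [HEdge.bd] using this
  unfold allAdmissible
  rw [List.mem_map]
  refine ⟨t, List.mem_flatMap.2 ⟨P.length, List.mem_range.2 (by omega), ?_⟩, toPairs_flatMap P⟩
  rw [← hlen]
  exact mem_injLists hnd htbd

/-- The angles of `H` in code. [cite: GlazmanManolescu2019, §4.2] -/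
theorem topAng_eq (θ₁ θ₂ : ℝ) (f : HFace) : topAng θ₁ θ₂ f = angleOfCode θ₁ θ₂ (topCode f) := by
  cases f <;> rfl

/-- The angles of `H'` in code. [cite: GlazmanManolescu2019, §4.2] -/
theorem botAng_eq (θ₁ θ₂ : ℝ) (f : HFace) : botAng θ₁ θ₂ f = angleOfCode θ₁ θ₂ (botCode f) := by
  cases f <;> rfl

/-- **Proposition 3.1 (the Yang–Baxter equation) for the hexagon of the column exchange**: for every
admissible list `P` of pairs of distinct boundary points, the total weight of the families of
disjoint walks inside `H` joining these pairs equals that inside `H'`: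
`Z_H(P) = Z_{H'}(P)` — rhombi of angles `θ₁`, `θ₂ ∈ [π/3, 2π/3]`-like (non-vanishing
denominators) and `θ₂ − θ₁`. [cite: GlazmanManolescu2019, Proposition 3.1] -/
theorem Zloc_topHex_eq_botHex (θ₁ θ₂ : ℝ) (h1 : weightDen θ₁ ≠ 0) (h2 : weightDen θ₂ ≠ 0)
    (hd : weightDen (θ₂ - θ₁) ≠ 0) {P : List (HEdge × HEdge)} (hP : admissibleB P = true) :
    (topHex θ₁ θ₂).Zloc Finset.univ hexInt P = (botHex θ₁ θ₂).Zloc Finset.univ hexInt P := by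
  have hgood := List.all_eq_true.1 ybGood_allAdmissible P (mem_allAdmissible hP)
  unfold ybGood at hgood
  simp only [Bool.and_eq_true, Bool.or_eq_true, beq_iff_eq, List.any_eq_true, decide_eq_true_eq] at hgood
  obtain ⟨⟨hcase, hnd₁⟩, hnd₂⟩ := hgood
  rw [topHex, botHex, Zloc_hexCx (tbl := topTbl) _ topCode θ₁ θ₂ (topAng_eq θ₁ θ₂) (fun f => by cases f <;> decide) P hnd₁,
    Zloc_hexCx (tbl := botTbl) _ botCode θ₁ θ₂ (botAng_eq θ₁ θ₂) (fun f => by cases f <;> decide) P hnd₂]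
  rcases hcase with heq | ⟨e, he, ⟨hl, hr⟩ | ⟨hl, hr⟩⟩
  · rw [heq]
  · rw [← hl, ← hr]; exact ybTable_sound θ₁ θ₂ h1 h2 hd e he
  · rw [← hl, ← hr]; exact (ybTable_sound θ₁ θ₂ h1 h2 hd e he).symm

/-! ### Local transport: the local partition function of an embedded hexagon -/

namespace Cx

section LocEmb

variable {F₀ E₀ F E : Type*} [DecidableEq F₀] [DecidableEq E₀] [DecidableEq F] [DecidableEq E]

/-- **An embedding of a small complex `X` (all of whose faces form the piece, with interior edges
`Int₀`) onto the piece `H` (interior edges `IntH`, boundary edges `BdH`) of a complex `K`**: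
injective maps of faces and edges, onto `H` and onto `IntH` on the interior, into `BdH` elsewhere,
commuting with sides and angles. [folklore] -/
structure LocEmb (X : Cx F₀ E₀) (K : Cx F E) (H : Finset F) (IntH BdH : Finset E) (Int₀ : Finset E₀) where
  /-- the map of faces -/
  φF : F₀ → F
  /-- the map of edges -/
  φE : E₀ → E
  /-- faces are mapped injectively -/
  injF : Function.Injective φF
  /-- edges are mapped injectively -/
  injE : Function.Injective φE
  /-- the faces of `X` are mapped onto `H` -/
  mem_H : ∀ f, f ∈ H ↔ ∃ x, φF x = f
  /-- interior edges correspond -/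
  mem_Int : ∀ x, φE x ∈ IntH ↔ x ∈ Int₀
  /-- every interior edge of `H` comes from `X` -/
  int_sub : ∀ e ∈ IntH, ∃ x, φE x = e
  /-- the other edges of `X` are mapped to boundary edges of `H` -/
  mem_Bd : ∀ x, x ∉ Int₀ → φE x ∈ BdH
  /-- sides are preserved -/
  side_eq : ∀ x s, K.side (φF x) s = φE (X.side x s)
  /-- angles are preserved -/
  angle_eq : ∀ x, K.angle (φF x) = X.angle x

namespace LocEmb

variable {X : Cx F₀ E₀} {K : Cx F E} {D : Set F} {H : Finset F} {IntH BdH : Finset E} {Int₀ : Finset E₀}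
  (ι : LocEmb X K H IntH BdH Int₀)

omit [DecidableEq F₀] [DecidableEq E₀] [DecidableEq F] [DecidableEq E] in
/-- **The face of a mapped arc**: the image of the face of the arc in `X`, and no face at all if the
arc has none in `X` (no rhombus outside `H` has two edges of `IntH ∪ ∂H` among the images as
sides). [cite: GlazmanManolescu2019, Corollary 3.2 (proof)] -/
theorem arcFace_map (hX : X.Lawful) (hK : K.Lawful) (hS : K.SubCx D H IntH BdH) (p : E₀ × E₀) :
    K.arcFace (Prod.map ι.φE ι.φE p) = (X.arcFace p).map ι.φF := by
  rcases hx : X.arcFace p with _ | x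
  · rw [Option.map_none]
    by_contra hne
    obtain ⟨f, hf⟩ := Option.ne_none_iff_exists'.1 hne
    obtain ⟨hne', ⟨s, hs⟩, ⟨t, ht⟩⟩ := (hK.commonFace_eq_some_iff _ _ f).1 hf
    simp only [Prod.map_fst, Prod.map_snd] at hne' hs ht
    have hp : p.1 ≠ p.2 := fun h => hne' (by rw [h])
    by_cases hfH : f ∈ H
    · obtain ⟨y, rfl⟩ := (ι.mem_H f).1 hfH
      rw [ι.side_eq] at hs ht
      have : X.arcFace p = some y :=
        (hX.commonFace_eq_some_iff _ _ y).2 ⟨hp, ⟨s, ι.injE hs⟩, ⟨t, ι.injE ht⟩⟩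
      rw [hx] at this
      cases this
    · have h1 : ι.φE p.1 ∈ BdH := by
        by_cases h : p.1 ∈ Int₀
        · exact absurd (hS.int_faces _ ((ι.mem_Int _).2 h) f s hs) hfH
        · exact ι.mem_Bd _ h
      have h2 : ι.φE p.2 ∈ BdH := by
        by_cases h : p.2 ∈ Int₀
        · exact absurd (hS.int_faces _ ((ι.mem_Int _).2 h) f t ht) hfH
        · exact ι.mem_Bd _ h
      exact hS.bd_outside _ h1 _ h2 hne' f hfH ⟨s, hs⟩ ⟨t, ht⟩
  · rw [Option.map_some]
    obtain ⟨hp, ⟨s, hs⟩, ⟨t, ht⟩⟩ := (hX.commonFace_eq_some_iff _ _ x).1 hx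
    exact (hK.commonFace_eq_some_iff _ _ _).2
      ⟨fun h => hp (ι.injE h), ⟨s, by rw [Prod.map_fst, ι.side_eq, hs]⟩, ⟨t, by rw [Prod.map_snd, ι.side_eq, ht]⟩⟩

omit [DecidableEq F₀] [DecidableEq E₀] [DecidableEq F] [DecidableEq E] in
/-- `sideOf` is preserved. [folklore] -/
theorem sideOf_map (hX : X.Lawful) (hK : K.Lawful) (x : F₀) (e : E₀) :
    K.sideOf (ι.φF x) (ι.φE e) = X.sideOf x e := by
  ext s
  rw [hK.sideOf_eq_some_iff, hX.sideOf_eq_some_iff, ι.side_eq, ι.injE.eq_iff]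

omit [DecidableEq F₀] [DecidableEq E₀] [DecidableEq F] [DecidableEq E] in
/-- The kind of a mapped arc. [folklore] -/
theorem arcKindOf_map (hX : X.Lawful) (hK : K.Lawful) (hS : K.SubCx D H IntH BdH) {p : E₀ × E₀} {x : F₀}
    (hp : X.arcFace p = some x) : K.arcKindOf (Prod.map ι.φE ι.φE p) = X.arcKindOf p := by
  unfold arcKindOf
  rw [ι.arcFace_map hX hK hS, hp, Option.map_some, Option.bind_some, Option.bind_some, Prod.map_fst, Prod.map_snd,
    ι.sideOf_map hX hK, ι.sideOf_map hX hK]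

omit [DecidableEq F₀] [DecidableEq E₀] [DecidableEq F] [DecidableEq E] in
/-- `insideRuns` commutes with mapping the edges. [folklore] -/
theorem insideRuns_map (φ : E₀ → E) (P : List (E₀ × E₀)) (κ : List (List E₀)) :
    insideRuns (P.map (Prod.map φ φ)) (κ.map (List.map φ)) = (insideRuns P κ).map (List.map φ) := by
  induction P generalizing κ with
  | nil => rfl
  | cons xy P ih =>
    cases κ with
    | nil => rfl
    | cons b κ => rw [List.map_cons, List.map_cons, insideRuns_cons, insideRuns_cons, List.map_cons, ih]; simp

omit [DecidableEq F₀] [DecidableEq E₀] [DecidableEq F] [DecidableEq E] in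
/-- `insidePairs` commutes with mapping the edges. [folklore] -/
theorem insidePairs_map (φ : E₀ → E) (P : List (E₀ × E₀)) (κ : List (List E₀)) :
    insidePairs (P.map (Prod.map φ φ)) (κ.map (List.map φ)) = (insidePairs P κ).map (Prod.map φ φ) := by
  rw [insidePairs, insidePairs, insideRuns_map, List.map_flatMap, List.flatMap_map]
  exact List.flatMap_congr fun r _ => pairsOf_map φ r

variable [Fintype F₀]

omit [DecidableEq F₀] [DecidableEq E₀] [DecidableEq F] [DecidableEq E] in
/-- **Local admissibility is preserved and reflected by the embedding.** [cite: GlazmanManolescu2019, Corollary 3.2 (proof)] -/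
theorem locValid_map_iff (hX : X.Lawful) (hK : K.Lawful) (hS : K.SubCx D H IntH BdH) (P : List (E₀ × E₀))
    (κ : List (List E₀)) :
    K.LocValid H IntH (P.map (Prod.map ι.φE ι.φE)) (κ.map (List.map ι.φE)) ↔ X.LocValid Finset.univ Int₀ P κ := by
  have hpairs := insidePairs_map ι.φE P κ
  have hruns := insideRuns_map ι.φE P κ
  have harc : ∀ p, K.arcFace (Prod.map ι.φE ι.φE p) = (X.arcFace p).map ι.φF := ι.arcFace_map hX hK hS
  have hmem : ∀ (a b : E₀), (ι.φE a, ι.φE b) ∈ (insidePairs P κ).map (Prod.map ι.φE ι.φE) ↔ (a, b) ∈ insidePairs P κ := by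
    intro a b
    rw [List.mem_map]
    constructor
    · rintro ⟨q, hq, hq'⟩
      obtain ⟨q1, q2⟩ := q
      simp only [Prod.map, Prod.mk.injEq] at hq'
      rwa [← ι.injE hq'.1, ← ι.injE hq'.2]
    · exact fun h => ⟨(a, b), h, rfl⟩
  have hchain : ∀ r : List E₀, (pairsOf (r.map ι.φE)).IsChain (fun p q => K.arcFace p ≠ K.arcFace q) ↔
      (pairsOf r).IsChain fun p q => X.arcFace p ≠ X.arcFace q := by
    intro r
    rw [pairsOf_map, List.isChain_map]
    exact List.IsChain.iff fun p q => by
      simp only [harc, ne_eq, (Option.map_injective ι.injF).eq_iff]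
  constructor
  · intro h
    refine ⟨by simpa using h.length_eq, fun b hb e he => ?_, ?_, fun p hp => ?_, fun r hr => ?_, fun x _ hWE hSN => ?_⟩
    · exact (ι.mem_Int e).1 (h.subset (b.map ι.φE) (List.mem_map_of_mem hb) _ (List.mem_map_of_mem he))
    · have := h.nodup
      rw [← List.map_flatten, List.nodup_map_iff ι.injE] at this
      exact this
    · obtain ⟨f, hfH, hf⟩ := h.arc_mem (Prod.map ι.φE ι.φE p) (by rw [hpairs]; exact List.mem_map_of_mem hp)
      rw [harc] at hf
      rcases hx : X.arcFace p with _ | x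
      · rw [hx] at hf; cases hf
      · exact ⟨x, Finset.mem_univ _, rfl⟩
    · have := h.isChain (r.map ι.φE) (by rw [hruns]; exact List.mem_map_of_mem hr)
      exact (hchain r).1 this
    · have hx := (ι.mem_H _).2 ⟨x, rfl⟩
      have := h.noncross (ι.φF x) hx
      simp only [ι.side_eq, hpairs, hmem] at this
      exact this hWE hSN
  · intro h
    refine ⟨by simpa using h.length_eq, fun b hb e he => ?_, ?_, fun p hp => ?_, fun r hr => ?_, fun f hf hWE hSN => ?_⟩
    · obtain ⟨b₀, hb₀, rfl⟩ := List.mem_map.1 hb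
      obtain ⟨e₀, he₀, rfl⟩ := List.mem_map.1 he
      exact (ι.mem_Int e₀).2 (h.subset b₀ hb₀ e₀ he₀)
    · rw [← List.map_flatten, List.nodup_map_iff ι.injE]
      exact h.nodup
    · rw [hpairs] at hp
      obtain ⟨q, hq, rfl⟩ := List.mem_map.1 hp
      obtain ⟨x, -, hx⟩ := h.arc_mem q hq
      exact ⟨ι.φF x, (ι.mem_H _).2 ⟨x, rfl⟩, by rw [harc, hx, Option.map_some]⟩
    · rw [hruns] at hr
      obtain ⟨r₀, hr₀, rfl⟩ := List.mem_map.1 hr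
      exact (hchain r₀).2 (h.isChain r₀ hr₀)
    · obtain ⟨x, rfl⟩ := (ι.mem_H f).1 hf
      have := h.noncross x (Finset.mem_univ _)
      simp only [ι.side_eq, hpairs, hmem] at hWE hSN
      exact this hWE hSN

omit [DecidableEq F₀] [DecidableEq E₀] [DecidableEq F] [DecidableEq E] [Fintype F₀] in
/-- A locally admissible family of `H` is the image of a family of `X`. [folklore] -/
theorem exists_eq_map_of_locValid [Nonempty E₀] {P' : List (E × E)} {κ' : List (List E)}
    (h : K.LocValid H IntH P' κ') : ∃ κ : List (List E₀), κ' = κ.map (List.map ι.φE) := by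
  classical
  refine ⟨κ'.map (List.map (Function.invFun ι.φE)), ?_⟩
  rw [List.map_map, eq_comm]
  conv_rhs => rw [← List.map_id κ']
  refine List.map_congr_left fun b hb => ?_
  rw [Function.comp_apply, List.map_map]
  conv_rhs => rw [← List.map_id b]
  refine List.map_congr_left fun e he => ?_
  obtain ⟨x, hx⟩ := ι.int_sub e (h.subset b hb e he)
  exact Function.invFun_eq ⟨x, hx⟩

omit [DecidableEq E₀] [DecidableEq E] [Fintype F₀] in
/-- The kinds of the inside arcs in an image face. [folklore] -/
theorem kindsLoc_map (hX : X.Lawful) (hK : K.Lawful) (hS : K.SubCx D H IntH BdH) (P : List (E₀ × E₀))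
    (κ : List (List E₀)) (x : F₀) :
    K.kindsLoc (P.map (Prod.map ι.φE ι.φE)) (κ.map (List.map ι.φE)) (ι.φF x) = X.kindsLoc P κ x := by
  unfold kindsLoc
  rw [insidePairs_map, List.filterMap_map]
  refine filterMap_congr_of_mem fun p _ => ?_
  rw [Function.comp_apply, ι.arcFace_map hX hK hS]
  rcases hp : X.arcFace p with _ | y
  · simp
  · rw [Option.map_some]
    by_cases hyx : y = x
    · subst hyx
      rw [if_pos rfl, if_pos rfl, ι.arcKindOf_map hX hK hS hp]
    · rw [if_neg (fun h => hyx (ι.injF (Option.some_injective _ h))), if_neg (fun h => hyx (Option.some_injective _ h))]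

omit [DecidableEq E₀] [DecidableEq E] in
/-- **The weight of a family is preserved by the embedding.** [cite: GlazmanManolescu2019, Corollary 3.2 (proof)] -/
theorem wLoc_map (hX : X.Lawful) (hK : K.Lawful) (hS : K.SubCx D H IntH BdH) (P : List (E₀ × E₀)) (κ : List (List E₀)) :
    K.wLoc H (P.map (Prod.map ι.φE ι.φE)) (κ.map (List.map ι.φE)) = X.wLoc Finset.univ P κ := by
  unfold wLoc
  have hH : H = Finset.univ.image ι.φF := by
    ext f; rw [ι.mem_H, Finset.mem_image]; simp
  have key : ∀ S : Finset F, S = Finset.univ.image ι.φF →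
      ∏ f ∈ S, localWeight (K.angle f) (K.kindsLoc (P.map (Prod.map ι.φE ι.φE)) (κ.map (List.map ι.φE)) f) =
        ∏ x, localWeight (X.angle x) (X.kindsLoc P κ x) := by
    rintro S rfl
    rw [Finset.prod_image fun x _ y _ h => ι.injF h]
    exact Finset.prod_congr rfl fun x _ => by rw [ι.angle_eq, ι.kindsLoc_map hX hK hS]
  exact key H hH

omit [DecidableEq E₀] in
/-- **The local partition function is preserved by the embedding**: `Z_H(φ P) = Z_X(P)`.
[cite: GlazmanManolescu2019, Corollary 3.2 (proof)] -/
theorem Zloc_map [Nonempty E₀] (hX : X.Lawful) (hK : K.Lawful) (hS : K.SubCx D H IntH BdH) (P : List (E₀ × E₀)) :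
    K.Zloc H IntH (P.map (Prod.map ι.φE ι.φE)) = X.Zloc Finset.univ Int₀ P := by
  classical
  unfold Zloc
  have hset : K.locSol H IntH (P.map (Prod.map ι.φE ι.φE)) = (X.locSol Finset.univ Int₀ P).image (List.map (List.map ι.φE)) := by
    ext κ'
    rw [mem_locSol, Finset.mem_image]
    constructor
    · intro h
      obtain ⟨κ, rfl⟩ := ι.exists_eq_map_of_locValid h
      exact ⟨κ, (mem_locSol _).2 ((ι.locValid_map_iff hX hK hS P κ).1 h), rfl⟩
    · rintro ⟨κ, hκ, rfl⟩
      exact (ι.locValid_map_iff hX hK hS P κ).2 ((mem_locSol _).1 hκ)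
  have hinj : Function.Injective (List.map (List.map ι.φE)) :=
    List.map_injective_iff.2 (List.map_injective_iff.2 ι.injE)
  rw [hset, Finset.sum_image fun κ _ κ' _ h => hinj h]
  exact Finset.sum_congr rfl fun κ _ => ι.wLoc_map hX hK hS P κ

end LocEmb

end LocEmb

end Cx

end Literature.Probability.RandomPlanarGeometry.SAW.YangBaxter
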